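import Summits.SmoothPoincare4.SmoothPoincare4.Theorems.CongruenceShadowsShadowApproximationEpiClassLivingstonDefs
import Summits.SmoothPoincare4.SmoothPoincare4.Theorems.CongruenceShadowsShadowApproximationStubLatticeIdentity
import Summits.SmoothPoincare4.SmoothPoincare4.Theorems.CongruenceShadowsShadowApproximationStubAutFreeGroupRealisesGL
import Summits.SmoothPoincare4.SmoothPoincare4.Theorems.CongruenceShadowsShadowApproximationStubFramingZero
import Summits.SmoothPoincare4.SmoothPoincare4.Theorems.ShadowApproximation.Negative.ShadowsOnlyFalse

/-!
# Line `epi-class-livingston` — crux `CongruenceShadows.ShadowApproximation` (stmt-SmoothPoincare4-14595)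

LEAD RESHAPE r1 (prover-line-stmt-SmoothPoincare4-14595-0, 2026-08-16): vocabulary moved to the landed file
`Theorems/CongruenceShadowsShadowApproximationEpiClassLivingstonDefs.lean`; the dictionary stub
`stub_constantAvatarZero` is split into three registered stubs stated over tree notions —
`stub_latticeIdentity` (1a, `[S,S] ≤ Kᵢ(Kⱼ ∩ Kₗ)`), `stub_autFreeGroupRealisesGL` (1b, `Aut F₃ ↠ GL₃(ℤ)`),
`stub_framingZero` (1c, 1a → 1b → `ConstantAvatarAt 0`) — composed as `constantAvatarZero`; stubs 2–4
unchanged. 6 stubs ≤ stubs_max = 7; composition `ShadowApproximation_of` unchanged in shape.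

Skeleton (crux-plan, round 1) for the idea card `epi-class-livingston` (ideator 2; triage
TRIAGE-r1-2: pass, TRIAGE-r1-3: pass, sharpenings (a) kill-switch computation first, (b) level
symmetries must not be asked to lift — both acted on below).

## The objects (all local, over existing declarations; no new Literature definitions)

* `S m = SurfaceGroup (3+3m)`, `N m = s4Kernels.stabilizeIter m` (standard `(3+3m; m+1)` triple),
  `H m i = S m ⧸ N m i` (= `π₁` of the `i`-th standard handlebody, free of rank `3(m+1)`),
  `T m = Π i, H m i`.
* The **standard handlebody avatar** `stdPhi m : S m →* T m`, `s ↦ (s mod N₀, s mod N₁, s mod N₂)`,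
  and its image `Pstd m ≤ T m` (at `m = 0`: the subdirect product
  `P_std = {x̄₁ = ȳ₁, x̄₂ = z̄₂, ȳ₃ = z̄₃} ≤ F₃³ ⊇ γ₂(F₃)³` of the card, by the PROVED lattice identity
  `[S,S] ≤ Kᵢ(Kⱼ ∩ Kₗ)`, ideator Sketch `tripleMeetCommutator_holds`, triage F1/N2).
* A **framing** of a kernel triple `K` is `φ : Π i, S m →* H m i` with `ker φᵢ = Kᵢ` and joint image
  `range (MonoidHom.pi φ) = Pstd m` (`IsFraming`).
* **Livingston–Zimmermann stable equivalence** `StablyEquivalent m Φ Ψ` of two homs `S m →* G`: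
  after killing `3n` added handles (`collapseIter`, built here from `surfaceRelator_add_three`) they
  differ by an automorphism of `S_{3+3m+3n}`. By Livingston 1985 / Zimmermann 1987 (proof by
  bordism, Dunfield–Thurston 2006 Thm 6.8/6.11; `Ω₂(BG) = H₂(G;ℤ)`), for `Ψ` ONTO `G` this is
  EXACTLY `Φ_*[Σ] = ±Ψ_*[Σ] ∈ H₂(G;ℤ)`. Hence
  `SigmaStandard m Φ := ∃ β ∈ Π Aut(H m i), StablyEquivalent (β ∘ Φ) (stdPhi m)` is the card's
  "`σ(Φ) ∈ ±Aut_Λ · σ(Φ_N)` in `H₂(P_std;ℤ) = H₂(E_Λ;ℤ)`", typed WITHOUT group homology.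
* `Equivalent m Φ := ∃ θ ∈ Aut S, β ∈ Π Aut(H m i), stdPhi = β ∘ Φ ∘ θ` (`Φ ∈ Aut_Λ · Φ_N · Aut S`).

## Stubs (sorried, registered) and composition

* `stub_constantAvatarZero` — DICTIONARY at genus 3 (provable now, size L): every Waldhausen-
  normalised, shadow-standard `(3;1,1,1)` group trisection of `{1}` has a framing onto `Pstd 0`.
* `stub_constantAvatarPos` — the same at `m ≥ 1` (Nielsen level: the framed JOINT image
  `S/(K₀∩K₁∩K₂) ≤ Π F_{3k}` is standard; weaker than the crux, open).
* `stub_separation` — SEPARATION (LOAD-BEARING bet): standard characteristic shadows (`hS`, verbatim: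
  level symmetries are whatever `ψ_M ∈ Aut S` induces, units included — they are NOT asked to
  lift) force the Livingston class to be standard: `SigmaStandard`.
* `stub_cancellation` — CANCELLATION (RESIDUAL, crux-strength on the σ-standard locus):
  Livingston-stably standard ⟹ standard (destabilisation of trivially-mapped handle triples; the
  bordism 3-manifold `W` with three surface systems).
* Composition (sorry-free glue): `iso_of_equivalent` (kernel bookkeeping `stdPhi = βΦθ ⟹ θ(Nᵢ) = Kᵢ`),
  `gate_of_parts`, `gate_of_allParts` (the four parts as hypotheses ⟹ the gate at every genus), and
  `ShadowApproximation_of : ShadowApproximation` (the route decl, BY NAME, from the four stubs).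
* Certificates (sorry-free): the standard triple is framed / σ-standard / equivalent
  (`framing_std`, `sigmaStandard_std`, `equivalent_std`), and `parts_of_gate` / `parts_of_crux`:
  the crux implies every stub at every genus — NO STUB IS FALSER THAN THE CRUX (a refutation of any
  stub refutes `ShadowApproximation`; route kill criterion 3: restate stably).

Disproof.lean (v4, gen 2 cycle 2) honoured: §3 `shadowApproximation_false_without_isGroupTrisection`
/ `not_iso_of_shadows_only` (junk `(N₀,N₁,N₂ ⊓ ker θ)`, landed `Negative/ShadowsOnlyFalse.lean`,
imported here) — `H = IsGroupTrisection` is used at `stub_constantAvatar*` (a framing `φ₂` with kernel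
`K₂` into the FREE group `H m 2` exists only because `S ⧸ K₂` is free: exactly the field
`free_quotient 2` the junk violates, `Negative/ShadowsOnlyFalseFields.lean`), and every avatar
statement quantifies over framed triples, which are group trisections of `{1}` automatically (triage
N3, AvatarKernels.lean); `junk_not_equivalent` below checks the junk against the avatar statements.
§6 (units obstruction, `not_strongShadowApproximation` / `not_levelSymmetriesLift`, unit twist `δ` at
level `M₅`, `Negative/UnitTwist.lean`): honoured — NO stub asks the output `α`/`β` to be congruent to
the input level standardisation `ψ_M`, and no level symmetry is asked to lift to `Aut S` or `Aut F`
(triage r1-3 (b)); `hS` enters `stub_separation` verbatim and its conclusion is up to `±Aut_Λ`, not up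
to level symmetries. §7 (`eq_of_idShadows`: identity shadows + separability force equality) locates
the whole difficulty in the `M`-dependence of `ψ_M` — which is exactly what `stub_separation` must
absorb into ONE stable equivalence.
-/

noncomputable section

namespace Summit.SmoothPoincare4.SmoothPoincare4.Cruxes.ShadowApproximation.EpiClassLivingston

set_option linter.dupNamespace false

open Literature.Topology.FourManifolds
open Summit.SmoothPoincare4.SmoothPoincare4.Theses.CongruenceShadows (ShadowApproximation)
open Summit.SmoothPoincare4.SmoothPoincare4.Theorems.ShadowApproximation.EpiClassLivingston

/-! ## 0. Vocabulary

All objects (`S`, `N`, `H`, `T`, `stdPhi`, `Pstd`, `Pairs`, `Shadows`, `IsFraming`, `collapse3`,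
`collapseIter`, `StablyEquivalent`, `SigmaStandard`, `Equivalent`, `ConstantAvatarAt`, `SeparationAt`,
`CancellationAt`) live in the landed vocabulary file
`Theorems/CongruenceShadowsShadowApproximationEpiClassLivingstonDefs.lean` (namespace
`…Theorems.ShadowApproximation.EpiClassLivingston`, opened below), so that the registered stub
signatures and the stub files `Theorems/CongruenceShadowsShadowApproximationStub*.lean` refer to ONE
set of declarations. -/

/-- WHAT `hS` HANDS OVER, LEVEL BY LEVEL (triage r1-3 (b) made explicit; cf. the unit twist `δ` of
`Negative/UnitTwist.lean`): an automorphism `ψ` of `S` and the isomorphisms of the FINITE level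
avatars `S ⧸ NᵢM ≃* S ⧸ KᵢM` it induces — level symmetries between finite quotients, not
automorphisms of one fixed `F/M̄`, and never asked to lift to `Aut S` or `Aut F`. `stub_separation`
starts from exactly this datum. -/
theorem levelAvatars_of_shadows {m : ℕ} {K : TrisectionKernels (3 + 3 * m)} [∀ i, (K i).Normal]
    (hS : ∀ M : Subgroup (S m), M.Characteristic → M.FiniteIndex →
      ∃ ψ : S m ≃* S m, ∀ i : Fin 3, (N m i ⊔ M).map ψ.toMonoidHom = K i ⊔ M)
    (M : Subgroup (S m)) [hM : M.Characteristic] [hMf : M.FiniteIndex] :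
    ∃ (ψ : S m ≃* S m) (Ξ : ∀ i : Fin 3, S m ⧸ (N m i ⊔ M) ≃* S m ⧸ (K i ⊔ M)),
      ∀ (i : Fin 3) (s : S m), Ξ i (s : S m ⧸ (N m i ⊔ M)) = (ψ s : S m ⧸ (K i ⊔ M)) := by
  obtain ⟨ψ, hψ⟩ := hS M hM hMf
  exact ⟨ψ, fun i => QuotientGroup.congr (N m i ⊔ M) (K i ⊔ M) ψ (hψ i), fun i s => rfl⟩

/-- READ-BACK: the crux is literally `∀ m K, IsGroupTrisection → Pairs → Shadows → Iso N K`. -/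
theorem crux_iff :
    ShadowApproximation ↔ ∀ (m : ℕ) (K : TrisectionKernels (3 + 3 * m)),
      IsGroupTrisection (3 + 3 * m) (m + 1) (PUnit : Type) K → Pairs m K → Shadows m K →
        TrisectionKernels.Iso (N m) K :=
  Iff.rfl

/-! ## 2. Registered stubs -/

/-! STUBS 1a, 1b, 1c — LANDED (lead wave 1, 2026-08-16): `stub_latticeIdentity` (p79262,
`Theorems/CongruenceShadowsShadowApproximationStubLatticeIdentity.lean`: `[S,S] ≤ Kᵢ ⊔ (Kⱼ ⊓ Kₗ)` for
`(3,1)` group trisections of `{1}`), `stub_autFreeGroupRealisesGL` (p80578, `…StubAutFreeGroupRealisesGL.lean`,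
from the general `Aut Fₙ ↠ GLₙ(ℤ)` of `Literature/GroupTheory/CombinatorialGroupTheory/AutFreeGroupAbelianisation.lean`,
p80100), `stub_framingZero` (p90214, `…StubFramingZero.lean` ← `…StubFramingZeroLevels.lean` p87271 ←
`…StubFramingZeroLattice.lean` p84478 ← `…StubFramingZeroAbelian.lean` p83261): imported above and used by
name (namespace `…Theorems.ShadowApproximation.EpiClassLivingston`, opened). -/

/-- The dictionary at genus 3 (`ConstantAvatarAt 0`), composed from the LANDED Stubs 1a, 1b, 1c: every
Waldhausen-normalised, shadow-standard `(3;1,1,1)` group trisection of `{1}` is framed onto `Pstd 0`. -/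
theorem constantAvatarZero : ConstantAvatarAt 0 :=
  stub_framingZero stub_latticeIdentity stub_autFreeGroupRealisesGL

/-- STUB 2 · `stub_constantAvatarPos` · `m ≥ 1`: the framed JOINT image of a normalised,
shadow-standard `(3+3m; m+1)` group trisection of `{1}` is the standard subgroup
`P_std,m ≤ Π F_{3(m+1)}` up to coordinate automorphisms. Nielsen-level statement (pairwise images are
standard fibre products by `hW`; the content is the simultaneous framing of the TRIPLE image), implied
by the crux, strictly weaker (it forgets the marking `S ↠ P_std,m`); tools: profinite rigidity of
finitely generated subgroups of free groups (M. Hall, Garrido–Jaikin-Zapirain) as in the sibling line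
`free-shadow-tsystem`. Size XL / open. -/
theorem stub_constantAvatarPos : ∀ m : ℕ, 0 < m → ConstantAvatarAt m := by
  sorry

/-- STUB 3 · `stub_separation` · SEPARATION (LOAD-BEARING): standard shadows ⟹ σ-standard.
Why plausible: the Livingston class is read by finite quotients (for FINITE targets it is the
complete stable invariant, DT06 Thm 6.11), `H₂(E_Λ;ℤ)` is a finitely generated torsion module over
`ℤ[ℤ³]` with explicit level symmetries, and orbit/genus questions for such modules are decidable with
a finite class set (Grunewald–Segal genre). Why it might fail: level symmetries exceed liftable ones
by units (route NUMBERS; `Negative/UnitTwist.lean`), so the levelwise orbit may be strictly coarser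
than `±Aut_Λ·σ(Φ_N)`. FIRST TASK before proving (triage (a)): the kill-switch computation of the
line card — if every admissible class is already `σ`-standard this stub is VACUOUS and the line is
costume. Implied by the crux (`parts_of_gate`). Size XL / research. -/
theorem stub_separation : ∀ m : ℕ, SeparationAt m := by
  sorry

/-- STUB 4 · `stub_cancellation` · CANCELLATION (RESIDUAL): σ-standard (+ normalised + shadow-
standard) ⟹ standard. It is the crux restricted to the σ-standard locus (one extra hypothesis),
i.e. `SPC4_g ∧` balanced 4-d Waldhausen`_g` there; its proper content is DESTABILISATION: a stable
equivalence is a bordism `W³` over `K(P_std,1) = E_Λ` between the two trisection diagrams, carrying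
three properly embedded surface systems (transversality to the edge midpoints of the three roses) —
attack by 3-manifold topology (Haken hierarchies of `W`, Stallings folding of the three maps
`W → R₃`). Note (line card §Cheapest falsifier): "bending" `Φ_N` along a STANDARD reducing curve
(conjugating the images of one standard handle by `p ∈ P_std`) keeps `σ` and is harmless — onto
`P_std` forces the coordinatewise partial conjugations to be automorphisms, so the kernel triple is
unchanged; genuinely new σ-standard markings need a NON-standard reducing curve of `N` (reducing-curve
uniqueness for the genus-3 trisection of `S⁴`) or a stabilise–twist–destabilise. Size: open-problem. -/
theorem stub_cancellation : ∀ m : ℕ, CancellationAt m := by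
  sorry

/-! ## 3. Composition (sorry-free): the four stubs prove the crux BY NAME -/

/-- Kernel bookkeeping: if `Φ_N = β ∘ Φ_K ∘ θ` then `θ(Nᵢ) = Kᵢ`, i.e. `Iso N K`. -/
theorem iso_of_equivalent {m : ℕ} {K : TrisectionKernels (3 + 3 * m)}
    {φ : ∀ i : Fin 3, S m →* H m i} (hker : ∀ i, (φ i).ker = K i)
    (h : Equivalent m (MonoidHom.pi φ)) : TrisectionKernels.Iso (N m) K := by
  obtain ⟨θ, β, hθ⟩ := h
  refine ⟨θ, fun i => ?_⟩
  have key : ∀ s : S m, s ∈ N m i ↔ θ s ∈ K i := fun s => by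
    have h1 := congrFun (hθ s) i
    simp only [stdPhi_apply, MulEquiv.piCongrRight_apply, MonoidHom.pi_apply] at h1
    rw [← hker i, MonoidHom.mem_ker, ← QuotientGroup.eq_one_iff, h1, MulEquiv.map_eq_one_iff]
  have hN : N m i = (K i).comap θ.toMonoidHom := by
    ext s
    simpa using key s
  rw [hN, Subgroup.map_comap_eq_self_of_surjective θ.surjective]

/-- **The gate at genus `3 + 3m` from the three parts**: frame (`ConstantAvatar`), separate
(`SigmaStandard`), cancel (`Equivalent`), read off the kernels (`Iso`). -/
theorem gate_of_parts (m : ℕ) (hA : ConstantAvatarAt m) (hSep : SeparationAt m)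
    (hC : CancellationAt m) (K : TrisectionKernels (3 + 3 * m))
    (hK : IsGroupTrisection (3 + 3 * m) (m + 1) (PUnit : Type) K) (hW : Pairs m K)
    (hS : Shadows m K) : TrisectionKernels.Iso (N m) K := by
  obtain ⟨φ, hφ⟩ := hA K hK hW hS
  exact iso_of_equivalent hφ.1 (hC K φ hK hW hS hφ (hSep K φ hK hW hS hφ))

/-- The four parts, as implications, give the gate at every genus (conclusion spelled out, so that
exactly one theorem of this file — `ShadowApproximation_of` — concludes the crux by name). -/
theorem gate_of_allParts (h0 : ConstantAvatarAt 0) (hpos : ∀ m : ℕ, 0 < m → ConstantAvatarAt m)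
    (hsep : ∀ m : ℕ, SeparationAt m) (hcan : ∀ m : ℕ, CancellationAt m) :
    ∀ (m : ℕ) (K : TrisectionKernels (3 + 3 * m)),
      IsGroupTrisection (3 + 3 * m) (m + 1) (PUnit : Type) K → Pairs m K → Shadows m K →
        TrisectionKernels.Iso (N m) K := by
  intro m K hK hW hS
  rcases Nat.eq_zero_or_pos m with rfl | hm
  · exact gate_of_parts 0 h0 (hsep 0) (hcan 0) K hK hW hS
  · exact gate_of_parts m (hpos m hm) (hsep m) (hcan m) K hK hW hS

/-- **The skeleton concludes the crux BY NAME.** `CongruenceShadows.ShadowApproximation`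
(stmt-SmoothPoincare4-14595) from the six registered stubs `stub_latticeIdentity`,
`stub_autFreeGroupRealisesGL`, `stub_framingZero` (together: the dictionary `constantAvatarZero`),
`stub_constantAvatarPos`, `stub_separation`, `stub_cancellation` and the sorry-free glue
(`gate_of_parts`: frame → separate → cancel → read off the kernels); sorries only inside `stub_*`. -/
theorem ShadowApproximation_of :
    _root_.Summit.SmoothPoincare4.SmoothPoincare4.Theses.CongruenceShadows.ShadowApproximation := by
  intro m K hK hW hS
  rcases Nat.eq_zero_or_pos m with rfl | hm
  · exact gate_of_parts 0 constantAvatarZero (stub_separation 0) (stub_cancellation 0) K hK hW hS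
  · exact gate_of_parts m (stub_constantAvatarPos m hm) (stub_separation m) (stub_cancellation m)
      K hK hW hS

/-! ## 4. Certificates (sorry-free): non-vacuity, and no stub is falser than the crux -/

section Certificates

variable (m : ℕ)

/-- The standard triple is framed by the quotient maps themselves. -/
theorem framing_std : IsFraming m (N m) (fun i => QuotientGroup.mk' (N m i)) :=
  ⟨fun i => QuotientGroup.ker_mk' (N m i), rfl⟩

/-- The standard avatar is equivalent to itself. -/
theorem equivalent_std : Equivalent m (stdPhi m) :=
  ⟨MulEquiv.refl _, fun _ => MulEquiv.refl _, fun _ => rfl⟩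

/-- `Equivalent ⟹ SigmaStandard` (no stabilisation needed: `n = 0`). -/
theorem sigmaStandard_of_equivalent {m : ℕ} {Φ : S m →* T m} (h : Equivalent m Φ) :
    SigmaStandard m Φ := by
  obtain ⟨θ, β, hθ⟩ := h
  exact ⟨β, 0, θ, MonoidHom.ext fun x => (hθ x).symm⟩

/-- NON-VACUITY: the standard avatar is σ-standard. -/
theorem sigmaStandard_std : SigmaStandard m (stdPhi m) :=
  sigmaStandard_of_equivalent (equivalent_std m)

variable {m}

/-- Each coordinate of a framing is onto (the joint image `P_std` projects onto each `π₁(Hᵢ)`). -/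
theorem framing_surjective {K : TrisectionKernels (3 + 3 * m)} {φ : ∀ i : Fin 3, S m →* H m i}
    (hφ : IsFraming m K φ) (i : Fin 3) : Function.Surjective (φ i) := by
  intro y
  obtain ⟨t, rfl⟩ := QuotientGroup.mk_surjective y
  have ht : stdPhi m t ∈ (MonoidHom.pi φ).range := by
    rw [hφ.2]
    exact ⟨t, rfl⟩
  obtain ⟨s, hs⟩ := ht
  exact ⟨s, by simpa using congrFun hs i⟩

/-- From `Iso N K`, every framing of `K` is equivalent to the standard avatar: `φᵢ ∘ α` is onto
`π₁(Hᵢ)` with kernel `Nᵢ`, so it IS `βᵢ ∘ (mod Nᵢ)` for a unique `βᵢ ∈ Aut π₁(Hᵢ)`. -/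
theorem equivalent_of_iso {K : TrisectionKernels (3 + 3 * m)} {φ : ∀ i : Fin 3, S m →* H m i}
    (hφ : IsFraming m K φ) (h : TrisectionKernels.Iso (N m) K) :
    Equivalent m (MonoidHom.pi φ) := by
  obtain ⟨α, hα⟩ := h
  have hsurj : ∀ i, Function.Surjective ((φ i).comp α.toMonoidHom) := fun i =>
    (framing_surjective hφ i).comp α.surjective
  have hker : ∀ i, ((φ i).comp α.toMonoidHom).ker = N m i := by
    intro i
    ext s
    rw [MonoidHom.mem_ker, MonoidHom.comp_apply, ← MonoidHom.mem_ker, hφ.1 i, ← hα i]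
    simp
  let β : ∀ i : Fin 3, H m i ≃* H m i := fun i =>
    (QuotientGroup.quotientMulEquivOfEq (hker i).symm).trans
      (QuotientGroup.quotientKerEquivOfSurjective _ (hsurj i))
  have hβ : ∀ (i : Fin 3) (s : S m), β i (s : H m i) = φ i (α s) := fun _ _ => rfl
  refine ⟨α, fun i => (β i).symm, fun s => funext fun i => ?_⟩
  simp only [stdPhi_apply, MulEquiv.piCongrRight_apply, MonoidHom.pi_apply]
  rw [MulEquiv.eq_symm_apply, hβ]

/-- From `Iso N K`, `K` is framed: `φᵢ := (mod Nᵢ) ∘ α⁻¹`. -/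
theorem framing_of_iso {K : TrisectionKernels (3 + 3 * m)} (h : TrisectionKernels.Iso (N m) K) :
    ∃ φ : ∀ i : Fin 3, S m →* H m i, IsFraming m K φ := by
  obtain ⟨α, hα⟩ := h
  refine ⟨fun i => (QuotientGroup.mk' (N m i)).comp α.symm.toMonoidHom, fun i => ?_, ?_⟩
  · ext s
    rw [MonoidHom.mem_ker, MonoidHom.comp_apply, QuotientGroup.mk'_apply, QuotientGroup.eq_one_iff,
      ← hα i]
    exact Subgroup.mem_map_equiv.symm
  · have hpi : (MonoidHom.pi fun i => (QuotientGroup.mk' (N m i)).comp α.symm.toMonoidHom) =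
        (stdPhi m).comp α.symm.toMonoidHom := MonoidHom.ext fun _ => rfl
    rw [hpi, MonoidHom.range_comp, MonoidHom.range_eq_top.2 α.symm.surjective,
      ← MonoidHom.range_eq_map]
    rfl

/-- **NO STUB IS FALSER THAN THE CRUX (at each genus).** The genus-`3+3m` gate — the crux's own
conclusion pattern — implies all three parts at that genus. -/
theorem parts_of_gate (m : ℕ)
    (gate : ∀ K : TrisectionKernels (3 + 3 * m),
      IsGroupTrisection (3 + 3 * m) (m + 1) (PUnit : Type) K → Pairs m K → Shadows m K →
        TrisectionKernels.Iso (N m) K) :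
    ConstantAvatarAt m ∧ SeparationAt m ∧ CancellationAt m :=
  ⟨fun K hK hW hS => framing_of_iso (gate K hK hW hS),
    fun K _ hK hW hS hφ => sigmaStandard_of_equivalent (equivalent_of_iso hφ (gate K hK hW hS)),
    fun K _ hK hW hS hφ _ => equivalent_of_iso hφ (gate K hK hW hS)⟩

/-- Hence the crux implies the statements of all four stubs: the skeleton is an EQUIVALENT
reformulation of `ShadowApproximation` (with `ShadowApproximation_of`). -/
theorem parts_of_crux
    (h : _root_.Summit.SmoothPoincare4.SmoothPoincare4.Theses.CongruenceShadows.ShadowApproximation) :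
    ConstantAvatarAt 0 ∧ (∀ m : ℕ, 0 < m → ConstantAvatarAt m) ∧ (∀ m : ℕ, SeparationAt m) ∧
      (∀ m : ℕ, CancellationAt m) :=
  ⟨(parts_of_gate 0 (h 0)).1, fun m _ => (parts_of_gate m (h m)).1,
    fun m => (parts_of_gate m (h m)).2.1, fun m => (parts_of_gate m (h m)).2.2⟩

/-- CHECK AGAINST THE LANDED NEGATIVE LEMMA (`Negative/ShadowsOnlyFalse.lean`): the disprover's junk
triple `J = (N₀, N₁, N₂ ⊓ ker θ)` has all finite shadows standard yet `¬ Iso N J`; the avatar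
statements cannot be fed with it — by `iso_of_equivalent`, NO framing of `J` is equivalent to the
standard avatar (and in fact `J` has no framing at all: `S ⧸ J₂` is not free,
`Negative/ShadowsOnlyFalseFields.junk_not_free_quotient_two`). -/
theorem junk_not_equivalent (φ : ∀ i : Fin 3, S 0 →* H 0 i)
    (hker : ∀ i, (φ i).ker =
      Summit.SmoothPoincare4.SmoothPoincare4.Theorems.ShadowApproximation.Negative.junk i) :
    ¬ Equivalent 0 (MonoidHom.pi φ) := fun h =>
  Summit.SmoothPoincare4.SmoothPoincare4.Theorems.ShadowApproximation.Negative.not_iso_junk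
    (iso_of_equivalent hker h)

end Certificates

end Summit.SmoothPoincare4.SmoothPoincare4.Cruxes.ShadowApproximation.EpiClassLivingston

end
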